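import Summits.ResolutionOfSingularities.ResolutionOfSingularities.Theorems.HomologicalConductorNoZenoExitDivisor
import Summits.ResolutionOfSingularities.ResolutionOfSingularities.Theorems.HomologicalConductorNoZenoCaptureStep
import Summits.ResolutionOfSingularities.ResolutionOfSingularities.Theorems.HomologicalConductorNoZenoOrdValuation
import Literature.AlgebraicGeometry.Resolution.NormalBirationalQuasiFinite
import Literature.AlgebraicGeometry.Resolution.LipmanValuativeQuadraticSequenceDivisorial
import HarnessLib

/-!
# Crux `NoZeno` / `NoZenoR` (stmt-ResolutionOfSingularities-16483 / -19943), line `sandwich-cluster`,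
# S2 `stub_regularOfBasePtsEmpty`, step (b): the ZMT DICHOTOMY for a regular point above a stage

Route `ResolutionOfSingularities/HomologicalConductor`.  OURS (cell res-hironaka); nothing here is a
statement of the manuscript under review.  Step (b) of the scheme-free proof plan of S2
(res-L0-w44-stub-3, `L/res-L0-w44-stub-3/S2-PLAN.md`): let `T ≤ S` be `k`-subalgebras of `K`
(`tr.deg_k K = 2`) with `T` a normal local domain (`Frac T = K`), `S` a REGULAR two-dimensional
local ring DOMINATING `T` and essentially of finite type over `T` (every element of `S` is `y/z`,
`y, z ∈ k[T ∪ g]` for a finite `g ⊆ S`, `z` a unit of `S`).  Then EITHER `T = S` OR some prime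
`P ≠ 𝔪_S` of `S` contains `𝔪_T` (a height-one prime of `S` contracting to `𝔪_T`: an exceptional
prime divisor `S_P` dominating `T`).  This is Zariski's Main Theorem in Grothendieck's form
(Stacks 00Q9), through the tree's birational local version
`Literature.AlgebraicGeometry.Resolution.bijective_algebraMap_of_essFiniteType_of_forall_isPrime`:
if every prime over `𝔪_T S` is `𝔪_S` then `T → S` is bijective, the residue field of `S` being
algebraic over `k` — which we get from the order valuation `E_S` (`S` has dimension two, so no
element of `S` is residually transcendental for `E_S`: `not_mem_of_residuallyTranscendental`).

* `mem_adjoin_inclusion_of_mem_adjoin` — transport of `k[T ∪ g] ⊆ K` into the `T`-subalgebra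
  `T[g]` of `S`;
* `essFiniteType_of_finset` — the elementary finiteness datum gives `Algebra.EssFiniteType T S`;
* `exists_aeval_mem_maximalIdeal` — `κ(S)/k` is algebraic for a regular two-dimensional `S`;
* `eq_or_exists_prime_of_dominates` — **the dichotomy.**
* `exists_exceptionalDivisor_of_ne` — if `T ≠ S`: the exceptional prime divisor `W = S_P` (a valuation
  ring dominating `T`, not dominating `S`, essentially generated by `S`, residually transcendental),
  packaged exactly like the exit divisor of `…ExitDivisor.lean`.

References: The Stacks Project, Tags 00Q9, 00PK [`StacksProject`]; O. Zariski, P. Samuel,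
Commutative Algebra II (1960), Ch. VIII §1 [`ZariskiSamuel1960`].
-/

noncomputable section

-- single-problem summit: the doubled namespace component `ResolutionOfSingularities` is forced
set_option linter.dupNamespace false

namespace Summit.ResolutionOfSingularities.ResolutionOfSingularities.Theorems.NoZeno.SandwichCluster

open Summit.ResolutionOfSingularities.ResolutionOfSingularities.Theses.HomologicalConductor
open Summit.ResolutionOfSingularities.ResolutionOfSingularities.Theorems.NoZeno.Birth
open Literature.AlgebraicGeometry.Resolution IsLocalRing Polynomial

variable {k K : Type} [Field k] [Field K] [Algebra k K]

/-! ## Finiteness: from fractions over `k[T ∪ g]` to `Algebra.EssFiniteType T S` -/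

/-- Transport: an element of `k[T ∪ g] ⊆ K` (`g ⊆ S`, `T ≤ S`) lies, as an element of `S`, in the
`T`-subalgebra of `S` generated by `g` (for the inclusion algebra `T → S`). [folklore] -/
theorem mem_adjoin_inclusion_of_mem_adjoin {T S : Subalgebra k K} (hTS : T ≤ S) (g : Finset K)
    (hg : (↑g : Set K) ⊆ S) {y : K} (hy : y ∈ Algebra.adjoin k ((T : Set K) ∪ ↑g)) (hyS : y ∈ S) :
    letI := (Subalgebra.inclusion hTS).toRingHom.toAlgebra
    (⟨y, hyS⟩ : ↥S) ∈ Algebra.adjoin ↥T {s : ↥S | (s : K) ∈ (↑g : Set K)} := by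
  letI := (Subalgebra.inclusion hTS).toRingHom.toAlgebra
  set A : Subalgebra ↥T ↥S := Algebra.adjoin ↥T {s : ↥S | (s : K) ∈ (↑g : Set K)} with hA
  -- the image of `A` in `K` is a `k`-subalgebra containing `T` and `g`
  have key : Algebra.adjoin k ((T : Set K) ∪ ↑g) ≤ (A.restrictScalars k).map S.val := by
    refine Algebra.adjoin_le ?_
    rintro z (hz | hz)
    · refine ⟨⟨z, hTS hz⟩, ?_, rfl⟩
      change (⟨z, hTS hz⟩ : ↥S) ∈ A
      have : (⟨z, hTS hz⟩ : ↥S) = algebraMap ↥T ↥S ⟨z, hz⟩ := rfl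
      rw [this]
      exact A.algebraMap_mem _
    · refine ⟨⟨z, hg hz⟩, ?_, rfl⟩
      change (⟨z, hg hz⟩ : ↥S) ∈ A
      exact Algebra.subset_adjoin hz
  obtain ⟨y', hy', hyy'⟩ := Subalgebra.mem_map.mp (key hy)
  have : y' = ⟨y, hyS⟩ := Subtype.ext hyy'
  rw [← this]
  exact hy'

/-- **Essential finiteness from the elementary datum**: if every element of `S` is `y * z⁻¹` with
`y, z ∈ k[T ∪ g]` (`g ⊆ S` finite) and `z⁻¹ ∈ S`, then `S` is essentially of finite type over `T`
(for the inclusion algebra). [folklore] -/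
theorem essFiniteType_of_finset {T S : Subalgebra k K} (hTS : T ≤ S) (g : Finset K)
    (hg : (↑g : Set K) ⊆ S)
    (hfin : ∀ s ∈ S, ∃ y ∈ Algebra.adjoin k ((T : Set K) ∪ ↑g),
      ∃ z ∈ Algebra.adjoin k ((T : Set K) ∪ ↑g), z⁻¹ ∈ S ∧ s = y * z⁻¹) :
    letI := (Subalgebra.inclusion hTS).toRingHom.toAlgebra
    Algebra.EssFiniteType ↥T ↥S := by
  classical
  letI := (Subalgebra.inclusion hTS).toRingHom.toAlgebra
  have hadjS : Algebra.adjoin k ((T : Set K) ∪ ↑g) ≤ S :=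
    Algebra.adjoin_le (Set.union_subset hTS hg)
  rw [Algebra.essFiniteType_iff]
  set σ : Finset ↥S := g.attach.image fun x => (⟨x.1, hg x.2⟩ : ↥S) with hσ
  have hsub : {s : ↥S | (s : K) ∈ (↑g : Set K)} ⊆ (σ : Set ↥S) := by
    intro s hs
    rw [hσ, Finset.coe_image]
    exact ⟨⟨(s : K), hs⟩, Finset.mem_coe.mpr (Finset.mem_attach _ _), Subtype.ext rfl⟩
  have hmono := Algebra.adjoin_mono (R := ↥T) hsub
  refine ⟨σ, fun s => ?_⟩
  obtain ⟨y, hy, z, hz, hzinv, hs⟩ := hfin s s.2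
  have hzS : z ∈ S := hadjS hz
  by_cases hz0 : z = 0
  · -- `s = 0`
    have hs0 : s = 0 := Subtype.ext (by rw [hs, hz0, inv_zero, mul_zero]; rfl)
    refine ⟨1, Subalgebra.one_mem _, isUnit_one, ?_⟩
    rw [hs0, zero_mul]
    exact Subalgebra.zero_mem _
  refine ⟨⟨z, hzS⟩, hmono (mem_adjoin_inclusion_of_mem_adjoin hTS g hg hz hzS),
    isUnit_of_inv_mem hz0 hzinv, ?_⟩
  have : s * ⟨z, hzS⟩ = ⟨y, hadjS hy⟩ := by
    apply Subtype.ext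
    change (s : K) * z = y
    rw [hs, mul_assoc, inv_mul_cancel₀ hz0, mul_one]
  rw [this]
  exact hmono (mem_adjoin_inclusion_of_mem_adjoin hTS g hg hy (hadjS hy))

/-! ## Residue field algebraicity of a regular two-dimensional point -/

/-- **`κ(S)/k` is algebraic** for a regular two-dimensional local `k`-subalgebra `S` of `K`
(`Frac S = K`, `tr.deg_k K = 2`): every `x ∈ S` satisfies `f(x) ∈ 𝔪_S` for some `0 ≠ f ∈ k[X]`.
Otherwise `x` would be residually transcendental for the order valuation `E_S`, which dominates
`S`, and a ring of dimension `2` closed under division by `E_S`-units contains no such element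
(`not_mem_of_residuallyTranscendental`). [cite: ZariskiSamuel1960, Ch. VIII §1] -/
theorem exists_aeval_mem_maximalIdeal (htr : Algebra.trdeg k K = 2) (S : Subalgebra k K)
    [IsRegularLocalRing ↥S] [IsFractionRing ↥S K] (hdim : ringKrullDim ↥S = 2) (x : ↥S) :
    ∃ f : k[X], f ≠ 0 ∧ aeval x f ∈ maximalIdeal ↥S := by
  obtain ⟨V, hV⟩ := exists_valuationSubring_coe_eq_ordSet S
  have hdom := dominates_ordSet_self S
  -- `S` is closed under division by `V`-units
  have hdiv : ∀ y ∈ S, ∀ u ∈ S, V.valuation u = 1 → y * u⁻¹ ∈ S := by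
    intro y hy u hu hvu
    have huinv : u⁻¹ ∈ (V : Set K) := by
      have h : u⁻¹ ∈ V := by
        rw [← V.valuation_le_one_iff, map_inv₀, hvu, inv_one]
      exact h
    rw [hV] at huinv
    exact S.mul_mem hy ((hdom u hu).2 huinv)
  by_contra hcon
  push Not at hcon
  have htt : ∀ p : k[X], p ≠ 0 → V.valuation (aeval (x : K) p) = 1 := by
    intro p hp
    have hmem : aeval (x : K) p ∈ V := by
      rw [Subalgebra.aeval_coe]
      have h : ((aeval x p : ↥S) : K) ∈ (V : Set K) := by rw [hV]; exact (hdom _ (aeval x p).2).1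
      exact h
    rcases ((V.valuation_le_one_iff _).mpr hmem).lt_or_eq with hlt | heq
    · exfalso
      rw [Subalgebra.aeval_coe, valuation_coe_lt_one_iff V hV] at hlt
      exact hcon p hp hlt
    · exact heq
  have h2 : (2 : WithBot ℕ∞) ≤ ringKrullDim ↥S := by rw [hdim]
  exact Lipman1978ValuativeQuadraticSequence.not_mem_of_residuallyTranscendental V htr S h2 hdiv
    htt x.2

/-! ## The dichotomy -/

/-- **ZMT dichotomy (S2 step (b)).**  Let `T ≤ S` be `k`-subalgebras of `K` (`tr.deg_k K = 2`): `T`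
local and integrally closed with `Frac T = K`; `S` regular local of dimension `2`, DOMINATING `T`
(an element of `T` inverted in `S` is inverted in `T`) and essentially of finite type over `T` (every
element of `S` is `y * z⁻¹` with `y, z ∈ k[T ∪ g]`, `g ⊆ S` finite, `z⁻¹ ∈ S`).  Then either `T = S`,
or some prime `P ≠ 𝔪_S` of `S` contains `𝔪_T` — i.e. `𝔪_T S` is not `𝔪_S`-primary, and (as
`dim S = 2`) `P` is a height-one prime with `P ∩ T = 𝔪_T`.  Proof: if every prime over `𝔪_T S` is
`𝔪_S`, the tree's birational Zariski Main Theorem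
(`bijective_algebraMap_of_essFiniteType_of_forall_isPrime`) applies, the residue field of `S` being
algebraic over `k ⊆ T` (`exists_aeval_mem_maximalIdeal`). [cite: StacksProject, Tag 00Q9] -/
theorem eq_or_exists_prime_of_dominates (htr : Algebra.trdeg k K = 2) (T S : Subalgebra k K)
    (hTS : T ≤ S) [IsLocalRing ↥T] [IsIntegrallyClosed ↥T] [IsFractionRing ↥T K]
    [IsRegularLocalRing ↥S] (hdim : ringKrullDim ↥S = 2)
    (hdom : ∀ t ∈ T, t⁻¹ ∈ S → t⁻¹ ∈ T) (g : Finset K) (hg : (↑g : Set K) ⊆ S)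
    (hfin : ∀ s ∈ S, ∃ y ∈ Algebra.adjoin k ((T : Set K) ∪ ↑g),
      ∃ z ∈ Algebra.adjoin k ((T : Set K) ∪ ↑g), z⁻¹ ∈ S ∧ s = y * z⁻¹) :
    T = S ∨ ∃ P : Ideal ↥S, P.IsPrime ∧ P ≠ maximalIdeal ↥S ∧
      ∀ (t : K) (ht : t ∈ T), (⟨t, ht⟩ : ↥T) ∈ maximalIdeal ↥T → (⟨t, hTS ht⟩ : ↥S) ∈ P := by
  classical
  haveI : IsFractionRing ↥S K := isFractionRing_subalgebra_of_le T S hTS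
  -- the inclusion algebra `T → S → K`
  letI : Algebra ↥T ↥S := (Subalgebra.inclusion hTS).toRingHom.toAlgebra
  have halgMap : ∀ t : ↥T, algebraMap ↥T ↥S t = ⟨(t : K), hTS t.2⟩ := fun _ => rfl
  haveI : IsScalarTower ↥T ↥S K := IsScalarTower.of_algebraMap_eq fun _ => rfl
  haveI : IsScalarTower k ↥T ↥S := IsScalarTower.of_algebraMap_eq fun _ => rfl
  haveI : Algebra.EssFiniteType ↥T ↥S := essFiniteType_of_finset hTS g hg hfin
  haveI : IsLocalHom (algebraMap ↥T ↥S) := ⟨fun t ht => by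
    by_cases ht0 : (t : K) = 0
    · exfalso
      apply ht.ne_zero
      exact Subtype.ext ht0
    exact isUnit_of_inv_mem ht0 (hdom _ t.2 (by
      have h := inv_mem_of_isUnit ht
      exact h))⟩
  -- the dichotomy on `𝔪_T S`
  by_cases hrad : ∀ P : Ideal ↥S, P.IsPrime →
      (maximalIdeal ↥T).map (algebraMap ↥T ↥S) ≤ P → P = maximalIdeal ↥S
  · left
    -- residue field algebraicity, then ZMT
    have halg : ∀ x : ↥S, ∃ p : (↥T)[X], (∃ i, p.coeff i ∉ maximalIdeal ↥T) ∧
        p.eval₂ (algebraMap ↥T ↥S) x ∈ maximalIdeal ↥S := by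
      intro x
      obtain ⟨f, hf0, hfx⟩ := exists_aeval_mem_maximalIdeal htr S hdim x
      refine ⟨f.map (algebraMap k ↥T), ⟨f.natDegree, ?_⟩, ?_⟩
      · rw [coeff_map]
        have hu : IsUnit (algebraMap k ↥T (f.coeff f.natDegree)) :=
          ((leadingCoeff_ne_zero.mpr hf0).isUnit).map _
        exact fun h => (mem_nonunits_iff.mp ((IsLocalRing.mem_maximalIdeal _).mp h)) hu
      · rw [eval₂_map, ← IsScalarTower.algebraMap_eq k ↥T ↥S, ← aeval_def]
        exact hfx
    have hbij := bijective_algebraMap_of_essFiniteType_of_forall_isPrime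
      (N := ↥T) (S := ↥S) (K := K) (fun _ _ h => Subtype.ext h) hrad halg
    refine le_antisymm hTS fun s hs => ?_
    obtain ⟨t, ht⟩ := hbij.2 ⟨s, hs⟩
    have : (t : K) = s := congrArg Subtype.val ht
    rw [← this]
    exact t.2
  · right
    push Not at hrad
    obtain ⟨P, hP, hle, hne⟩ := hrad
    refine ⟨P, hP, hne, fun t ht htm => hle ?_⟩
    rw [← halgMap ⟨t, ht⟩]
    exact Ideal.mem_map_of_mem _ htm

/-! ## The exceptional divisor of a proper regular point above `T` -/

/-- **The exceptional divisor (S2 steps (b)→(c)).**  In the situation of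
`eq_or_exists_prime_of_dominates` with `T ≠ S`, there is a valuation ring `W ≠ K` of `K`
containing `k` and `S`, essentially generated by `S` (`w = a * s⁻¹`, `a, s ∈ S`, `s⁻¹ ∈ W`), which
DOMINATES `T`, does NOT dominate `S`, and is residually transcendental over `k`: `W = S_P` for the
height-one prime `P ⊇ 𝔪_T` of the dichotomy (`S` is regular, hence normal, so `S_P` is a discrete
valuation ring; `S/P` is a domain over `k` which is not a field).  Same package as the exit divisor
of `…ExitDivisor.lean`, so that the DVR / finite-type bridge of `…ExitDivisorReach.lean` and
Zariski's theorem `exists_coe_eq_ordSet_of_isDiscreteValuationRing` apply to it verbatim.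
[cite: StacksProject, Tag 00Q9; ZariskiSamuel1960, Ch. VI §14 Thm. 33] -/
theorem exists_exceptionalDivisor_of_ne (htr : Algebra.trdeg k K = 2) (T S : Subalgebra k K)
    (hTS : T ≤ S) [IsLocalRing ↥T] [IsIntegrallyClosed ↥T] [IsFractionRing ↥T K]
    [IsRegularLocalRing ↥S] (hdim : ringKrullDim ↥S = 2)
    (hdom : ∀ t ∈ T, t⁻¹ ∈ S → t⁻¹ ∈ T) (g : Finset K) (hg : (↑g : Set K) ⊆ S)
    (hfin : ∀ s ∈ S, ∃ y ∈ Algebra.adjoin k ((T : Set K) ∪ ↑g),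
      ∃ z ∈ Algebra.adjoin k ((T : Set K) ∪ ↑g), z⁻¹ ∈ S ∧ s = y * z⁻¹)
    (hne : T ≠ S) :
    ∃ W : ValuationSubring K, W ≠ ⊤ ∧ (∀ c : k, algebraMap k K c ∈ W) ∧
      S.toSubring ≤ W.toSubring ∧
      (∀ w ∈ W, ∃ a ∈ S, ∃ s ∈ S, s⁻¹ ∈ W ∧ w = a * s⁻¹) ∧
      (∀ t ∈ T, t⁻¹ ∈ W → t⁻¹ ∈ T) ∧
      (∃ t ∈ S, t⁻¹ ∈ W ∧ t⁻¹ ∉ S) ∧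
      ∃ t ∈ W, ∀ p : k[X], p ≠ 0 → W.valuation (aeval t p) = 1 := by
  classical
  haveI := isDomain_of_isRegularLocalRing ↥S
  haveI : IsIntegrallyClosed ↥S := isIntegrallyClosed_of_isRegularLocalRing ↥S
  haveI : IsFractionRing ↥S K := isFractionRing_subalgebra_of_le T S hTS
  rcases eq_or_exists_prime_of_dominates htr T S hTS hdim hdom g hg hfin with h | ⟨P, hP, hPm, hTP⟩
  · exact absurd h hne
  haveI := hP
  -- `T` is not a field (else `T = K ⊇ S`), so `𝔪_T` has a nonzero element, which lies in `P`
  obtain ⟨t₀, ht₀T, ht₀m, ht₀0⟩ : ∃ t₀ : K, ∃ ht : t₀ ∈ T, (⟨t₀, ht⟩ : ↥T) ∈ maximalIdeal ↥T ∧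
      t₀ ≠ 0 := by
    by_contra hcon
    push Not at hcon
    apply hne (le_antisymm hTS fun s _ => ?_)
    have hF : IsField ↥T := by
      rw [IsLocalRing.isField_iff_maximalIdeal_eq, eq_bot_iff]
      intro t ht
      rw [Ideal.mem_bot]
      exact Subtype.ext (hcon t t.2 ht)
    obtain ⟨r, hr⟩ := (IsField.localization_map_bijective (M := nonZeroDivisors ↥T) (Rₘ := K)
      zero_notMem_nonZeroDivisors hF).2 s
    rw [← hr]
    exact r.2
  have hPbot : P ≠ ⊥ := by
    intro h
    have := hTP t₀ ht₀T ht₀m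
    rw [h, Ideal.mem_bot] at this
    exact ht₀0 (congrArg Subtype.val this)
  -- `P` has height one, so `S_P` is a discrete valuation ring
  have hPmax : ¬ P.IsMaximal := fun h => hPm (IsLocalRing.eq_maximalIdeal h)
  have hP1 : P.height = 1 := by
    refine le_antisymm (SyzygyFlattening.R1_height_le_one_of_not_isMaximal (by rw [hdim]) P hPmax) ?_
    rw [Order.one_le_iff_ne_zero]
    exact fun h => hPbot (Ideal.height_eq_zero_iff_eq_bot.mp h)
  haveI hdvr : IsDiscreteValuationRing (Localization.AtPrime P) :=
    isDiscreteValuationRing_localization_of_height_eq_one P hP1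
  let W : ValuationSubring K := placeOfPrime S P inferInstance
  have hWnu : ∀ s : ↥S, (s : K) ∈ W.nonunits ↔ s ∈ P :=
    coe_mem_nonunits_placeOfPrime_iff S P inferInstance
  have hSW : S.toSubring ≤ W.toSubring := le_placeOfPrime S P inferInstance
  have hunitW : ∀ s : ↥S, s ∉ P → (s : K)⁻¹ ∈ W := by
    intro s hs
    have h := (not_congr (hWnu s)).mpr hs
    rw [ValuationSubring.mem_nonunits_iff_or, not_or, not_not] at h
    exact h.2
  refine ⟨W, ?_, algebraMap_mem_placeOfPrime _ P inferInstance, hSW, ?_, ?_, ?_, ?_⟩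
  · -- `W ≠ ⊤`: `t₀⁻¹ ∉ W`
    intro htop
    have h := (hWnu ⟨t₀, hTS ht₀T⟩).mpr (hTP t₀ ht₀T ht₀m)
    rw [ValuationSubring.mem_nonunits_iff_or] at h
    rcases h with h | h
    · exact ht₀0 h
    · exact h (htop ▸ ValuationSubring.mem_top _)
  · -- essential generation by `S`
    intro w hw
    obtain ⟨b, s, hb, hs, hsu, hws⟩ := exists_mul_eq_of_mem_placeOfPrime S P inferInstance hw
    have h := hsu
    rw [ValuationSubring.mem_nonunits_iff_or, not_or, not_not] at h
    refine ⟨b, hb, s, hs, h.2, ?_⟩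
    rw [← hws, mul_assoc, mul_inv_cancel₀ h.1, mul_one]
  · -- `W` dominates `T`
    intro t ht htinv
    by_cases ht0 : t = 0
    · rw [ht0, inv_zero]; exact Subalgebra.zero_mem _
    have hnot : (t : K) ∉ W.nonunits := by
      rw [ValuationSubring.mem_nonunits_iff_or, not_or, not_not]
      exact ⟨ht0, htinv⟩
    have htP : (⟨t, hTS ht⟩ : ↥S) ∉ P := fun h => hnot ((hWnu _).mpr h)
    have htm : (⟨t, ht⟩ : ↥T) ∉ maximalIdeal ↥T := fun h => htP (hTP t ht h)
    rw [IsLocalRing.mem_maximalIdeal, mem_nonunits_iff, not_not] at htm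
    exact inv_mem_of_isUnit htm
  · -- `W` does not dominate `S`: an element of `𝔪_S ∖ P`
    have hlt : P < maximalIdeal ↥S := lt_of_le_of_ne (IsLocalRing.le_maximalIdeal hP.ne_top) hPm
    obtain ⟨s, hsm, hsP⟩ := SetLike.exists_of_lt hlt
    refine ⟨s, s.2, hunitW s hsP, fun hinv => ?_⟩
    have hs0 : (s : K) ≠ 0 := fun h => hsP (by rw [show s = 0 from Subtype.ext h]; exact P.zero_mem)
    exact (IsLocalRing.mem_maximalIdeal _).mp hsm (isUnit_of_inv_mem hs0 hinv)
  · -- residual transcendence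
    exact exists_residuallyTranscendental_of_not_isMaximal S P hPmax W hSW hWnu

end Summit.ResolutionOfSingularities.ResolutionOfSingularities.Theorems.NoZeno.SandwichCluster

end
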